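import Summits.RiemannHypothesis.RiemannHypothesis.Theorems.Splittings.RobinFiniteStairData
import Literature.NumberTheory.LFunctions.ThetaSmallRange
import HarnessLib

/-!
# RobinFiniteStairPieces — g18 «THE WHOLE STAIRCASE», part 4/9

The fourteen piece certificates are valid (`piece22_ok … piece35_ok` by `decide +kernel` + `norm_num` primality + the kernel θ-table
`abs_theta_sub_le_smallRange` for the block prime `R ≥ 599`) and THE STAIRCASE BOUND `theta_add_theta_add_lam_le_log : θP + θQ + Λ_K ≤ log
N` (`2^K ≤ P`, `22 ≤ K ≤ 35`).

Cell rh-split, seat rh-split-robin-finite g18 (brief sha16 f79c5f09d8bcb036), card `cards/SPLIT-robin-finite.md` §25; carved VERBATIM from the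
kernel-checked object `HOME/rh-split-robin-finite/g18/SketchG18.lean` (sha16 bca90f5376387c1c; `lean check` rc 0, 0 warnings, 0 sorries).  Zero `instance`,
zero `notation`, no attribute changes, no `native_decide` in this file; no `def … : Prop`; every conjecture / print fact appears only as an explicit
hypothesis (`Buthe2016_thm2`, `Buthe2018_thm2_theta`, `BroadbentEtAl2021_theta_rel_1e19`, `RiemannHypothesisUpTo T`).

THE LINE.  A colossally abundant `N = ∏ p^{a_p}` with largest prime `P` and structure prime `Q` (largest prime of exponent `≥ 2`) satisfies not
only `log N ≥ θ(P) + θ(Q)` (the tree) but `log N ≥ θ(P) + θ(Q) + Λ` with `Λ = Σ_{j≥3} θ(x_j)` the higher storeys of the Alaoglu–Erdős staircase;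
`Λ_K` is certified per dyadic piece `2^K ≤ P < 2^{K+1}` and spent on the analytic side as EXTRA zero-tail budget `d_k` on top of the tree's level
budgets `b_k` (`E_b` is affine in `b`; the gain `G₁^Λ − G₁` pays `d_k·w(P)`), so the SAME verified height `T` certifies a LONGER range of CA primes.

HONEST LABEL: «SPLITTING SEARCH over kernel-typed RH-EQUIVALENCES; a splitting A ∧ B ⟹ RH is CONDITIONAL bookkeeping unless A and B
are both proved; nothing here bears on the truth of RH.»
-/

set_option linter.dupNamespace false

noncomputable section

open Real Finset
open scoped ArithmeticFunction.sigma Chebyshev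

namespace Summit.RiemannHypothesis.RiemannHypothesis.Theorems.Splittings.RobinFiniteC1

section StaircasePieces

open Nat Literature.NumberTheory.LFunctions RobinAnalyticSharp.Cells

/-- the certificate list of piece `K`. -/
def certOf : ℕ → List (ℕ × ℕ × ℕ × ℕ)
  | 22 => cert22  | 23 => cert23  | 24 => cert24  | 25 => cert25  | 26 => cert26  | 27 => cert27  | 28 => cert28  | 29 => cert29  | 30 => cert30  | 31 => cert31  | 32 => cert32  | 33 => cert33  | 34 => cert34  | 35 => cert35
  | _ => []

/-- primality of the keys from a `List.Forall` certificate (discharged by `norm_num`). -/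
theorem certPrime_of_all {L : List (ℕ × ℕ × ℕ × ℕ)} (h : (L.map Prod.fst).Forall Nat.Prime) :
    ∀ q ∈ L, q.1.Prime := by
  rw [List.forall_iff_forall_mem] at h
  intro q hq
  exact h q.1 (List.mem_map.2 ⟨q, hq, rfl⟩)

/-- **θ at the block prime**, unconditionally from the tree's certified `θ` table (`abs_theta_sub_le_smallRange`,
`599 ≤ R ≤ 8 886 113`): `θ(R) ≥ R − s_R·((ν_R/100)·u₂)²/(8·π_L)` with `s_R ≥ √R`, `log R ≤ (ν_R/100) log 2 ≤ (ν_R/100) u₂`,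
`π ≥ π_L`. -/
theorem theta_block_lower {R nuR : ℕ} {sR : ℚ} (h599 : 599 ≤ R) (hR : R ≤ 8886113) (hν : R ^ 100 ≤ 2 ^ nuR)
    (hs : (R : ℚ) ≤ sR ^ 2) (hs0 : 0 ≤ sR) :
    (R : ℝ) - ((sR : ℚ) : ℝ) * ((nuR : ℝ) / 100 * ((u2 : ℚ) : ℝ)) ^ 2 / (8 * ((piL : ℚ) : ℝ)) ≤ θ (R : ℝ) := by
  have hRr : (599 : ℝ) ≤ R := by exact_mod_cast h599
  have hRr' : (R : ℝ) ≤ 8886113 := by exact_mod_cast hR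
  have habs := abs_theta_sub_le_smallRange hRr hRr'
  have hlow : (R : ℝ) - Real.sqrt R * Real.log R ^ 2 / (8 * Real.pi) ≤ θ (R : ℝ) := by
    have := (abs_le.1 habs).1; linarith
  have hsq : Real.sqrt (R : ℝ) ≤ ((sR : ℚ) : ℝ) := by
    have h1 : (R : ℝ) ≤ ((sR : ℚ) : ℝ) ^ 2 := by exact_mod_cast hs
    have h0 : (0 : ℝ) ≤ ((sR : ℚ) : ℝ) := by exact_mod_cast hs0
    calc Real.sqrt (R : ℝ) ≤ Real.sqrt (((sR : ℚ) : ℝ) ^ 2) := Real.sqrt_le_sqrt h1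
      _ = ((sR : ℚ) : ℝ) := Real.sqrt_sq h0
  have hlog : Real.log (R : ℝ) ≤ (nuR : ℝ) / 100 * ((u2 : ℚ) : ℝ) := by
    have h1 := log_le_of_cert (by omega) hν
    have h2 := le_u2
    have h3 : (0 : ℝ) ≤ (nuR : ℝ) / 100 := by positivity
    calc Real.log (R : ℝ) ≤ (nuR : ℝ) / 100 * Real.log 2 := h1
      _ ≤ (nuR : ℝ) / 100 * ((u2 : ℚ) : ℝ) := mul_le_mul_of_nonneg_left h2 h3
  have hlog0 : 0 ≤ Real.log (R : ℝ) := Real.log_nonneg (by linarith)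
  have hpi := piL_le
  have hpiL0 : (0 : ℝ) < ((piL : ℚ) : ℝ) := by simp only [piL]; push_cast; norm_num
  have hs0r : (0 : ℝ) ≤ ((sR : ℚ) : ℝ) := by exact_mod_cast hs0
  have hnum : Real.sqrt (R : ℝ) * Real.log R ^ 2 ≤ ((sR : ℚ) : ℝ) * ((nuR : ℝ) / 100 * ((u2 : ℚ) : ℝ)) ^ 2 :=
    mul_le_mul hsq (pow_le_pow_left₀ hlog0 hlog 2) (sq_nonneg _) hs0r
  have hfrac : Real.sqrt (R : ℝ) * Real.log R ^ 2 / (8 * Real.pi) ≤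
      ((sR : ℚ) : ℝ) * ((nuR : ℝ) / 100 * ((u2 : ℚ) : ℝ)) ^ 2 / (8 * ((piL : ℚ) : ℝ)) :=
    div_le_div₀ (by positivity) hnum (by positivity) (by linarith)
  linarith

/-- assembling a certified `Λ`: `lam ≤ θ(R) + (log 2/100)·NL` from a lower bound `c ≤ θ(R)`, `log 2 ≥ l₂` and the
rational check `lam ≤ c + l₂·NL/100`. -/
theorem lam_le_of {R NLv : ℕ} {lam : ℚ} {c : ℝ} {L : List (ℕ × ℕ × ℕ × ℕ)} (hNL : NL L = NLv) (hθ : c ≤ θ (R : ℝ))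
    (hcheck : ((lam : ℚ) : ℝ) ≤ c + ((l2 : ℚ) : ℝ) / 100 * NLv) :
    ((lam : ℚ) : ℝ) ≤ θ (R : ℝ) + Real.log 2 / 100 * (NL L : ℝ) := by
  rw [hNL]
  have hl2 := l2_le
  have hN0 : (0 : ℝ) ≤ (NLv : ℝ) := by positivity
  have : ((l2 : ℚ) : ℝ) / 100 * NLv ≤ Real.log 2 / 100 * NLv := by
    apply mul_le_mul_of_nonneg_right _ hN0
    linarith
  linarith

/-- piece `K = 22`: certificate sound, keys prime, `Λ_22 = lamQ 22 ≤ θ(0) + (log 2/100)·NL`. -/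
theorem piece22_ok : stairOK 22 (blockR 22) (blockNu 22) (certOf 22) = true ∧ (∀ q ∈ certOf 22, q.1.Prime) ∧
    ((lamQ 22 : ℚ) : ℝ) ≤ θ ((blockR 22 : ℕ) : ℝ) + Real.log 2 / 100 * (NL (certOf 22) : ℝ) := by
  refine ⟨by decide +kernel, certPrime_of_all (by simp only [certOf, cert22, List.map, List.Forall]; norm_num), ?_⟩
  refine lam_le_of (NLv := 46574) (c := 0) (by decide +kernel) (Chebyshev.theta_nonneg _) ?_
  simp only [lamQ, l2]; push_cast; norm_num

/-- piece `K = 23`: certificate sound, keys prime, `Λ_23 = lamQ 23 ≤ θ(0) + (log 2/100)·NL`. -/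
theorem piece23_ok : stairOK 23 (blockR 23) (blockNu 23) (certOf 23) = true ∧ (∀ q ∈ certOf 23, q.1.Prime) ∧
    ((lamQ 23 : ℚ) : ℝ) ≤ θ ((blockR 23 : ℕ) : ℝ) + Real.log 2 / 100 * (NL (certOf 23) : ℝ) := by
  refine ⟨by decide +kernel, certPrime_of_all (by simp only [certOf, cert23, List.map, List.Forall]; norm_num), ?_⟩
  refine lam_le_of (NLv := 60173) (c := 0) (by decide +kernel) (Chebyshev.theta_nonneg _) ?_
  simp only [lamQ, l2]; push_cast; norm_num

/-- piece `K = 24`: certificate sound, keys prime, `Λ_24 = lamQ 24 ≤ θ(0) + (log 2/100)·NL`. -/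
theorem piece24_ok : stairOK 24 (blockR 24) (blockNu 24) (certOf 24) = true ∧ (∀ q ∈ certOf 24, q.1.Prime) ∧
    ((lamQ 24 : ℚ) : ℝ) ≤ θ ((blockR 24 : ℕ) : ℝ) + Real.log 2 / 100 * (NL (certOf 24) : ℝ) := by
  refine ⟨by decide +kernel, certPrime_of_all (by simp only [certOf, cert24, List.map, List.Forall]; norm_num), ?_⟩
  refine lam_le_of (NLv := 72201) (c := 0) (by decide +kernel) (Chebyshev.theta_nonneg _) ?_
  simp only [lamQ, l2]; push_cast; norm_num

/-- piece `K = 25`: certificate sound, keys prime, `Λ_25 = lamQ 25 ≤ θ(0) + (log 2/100)·NL`. -/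
theorem piece25_ok : stairOK 25 (blockR 25) (blockNu 25) (certOf 25) = true ∧ (∀ q ∈ certOf 25, q.1.Prime) ∧
    ((lamQ 25 : ℚ) : ℝ) ≤ θ ((blockR 25 : ℕ) : ℝ) + Real.log 2 / 100 * (NL (certOf 25) : ℝ) := by
  refine ⟨by decide +kernel, certPrime_of_all (by simp only [certOf, cert25, List.map, List.Forall]; norm_num), ?_⟩
  refine lam_le_of (NLv := 90048) (c := 0) (by decide +kernel) (Chebyshev.theta_nonneg _) ?_
  simp only [lamQ, l2]; push_cast; norm_num

/-- piece `K = 26`: certificate sound, keys prime, `Λ_26 = lamQ 26 ≤ θ(0) + (log 2/100)·NL`. -/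
theorem piece26_ok : stairOK 26 (blockR 26) (blockNu 26) (certOf 26) = true ∧ (∀ q ∈ certOf 26, q.1.Prime) ∧
    ((lamQ 26 : ℚ) : ℝ) ≤ θ ((blockR 26 : ℕ) : ℝ) + Real.log 2 / 100 * (NL (certOf 26) : ℝ) := by
  refine ⟨by decide +kernel, certPrime_of_all (by simp only [certOf, cert26, List.map, List.Forall]; norm_num), ?_⟩
  refine lam_le_of (NLv := 109354) (c := 0) (by decide +kernel) (Chebyshev.theta_nonneg _) ?_
  simp only [lamQ, l2]; push_cast; norm_num

/-- piece `K = 27`: certificate sound, keys prime, `Λ_27 = lamQ 27 ≤ θ(719) + (log 2/100)·NL`. -/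
theorem piece27_ok : stairOK 27 (blockR 27) (blockNu 27) (certOf 27) = true ∧ (∀ q ∈ certOf 27, q.1.Prime) ∧
    ((lamQ 27 : ℚ) : ℝ) ≤ θ ((blockR 27 : ℕ) : ℝ) + Real.log 2 / 100 * (NL (certOf 27) : ℝ) := by
  refine ⟨by decide +kernel, certPrime_of_all (by simp only [certOf, cert27, List.map, List.Forall]; norm_num), ?_⟩
  have hθ := theta_block_lower (R := 719) (nuR := 949) (sR := 5363/200) (by norm_num) (by norm_num) (by decide +kernel)
    (by norm_num) (by norm_num)
  refine lam_le_of (NLv := 37735) (by decide +kernel) hθ ?_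
  simp only [lamQ, u2, piL, l2]; push_cast; norm_num

/-- piece `K = 28`: certificate sound, keys prime, `Λ_28 = lamQ 28 ≤ θ(911) + (log 2/100)·NL`. -/
theorem piece28_ok : stairOK 28 (blockR 28) (blockNu 28) (certOf 28) = true ∧ (∀ q ∈ certOf 28, q.1.Prime) ∧
    ((lamQ 28 : ℚ) : ℝ) ≤ θ ((blockR 28 : ℕ) : ℝ) + Real.log 2 / 100 * (NL (certOf 28) : ℝ) := by
  refine ⟨by decide +kernel, certPrime_of_all (by simp only [certOf, cert28, List.map, List.Forall]; norm_num), ?_⟩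
  have hθ := theta_block_lower (R := 911) (nuR := 984) (sR := 30183/1000) (by norm_num) (by norm_num) (by decide +kernel)
    (by norm_num) (by norm_num)
  refine lam_le_of (NLv := 43882) (by decide +kernel) hθ ?_
  simp only [lamQ, u2, piL, l2]; push_cast; norm_num

/-- piece `K = 29`: certificate sound, keys prime, `Λ_29 = lamQ 29 ≤ θ(1151) + (log 2/100)·NL`. -/
theorem piece29_ok : stairOK 29 (blockR 29) (blockNu 29) (certOf 29) = true ∧ (∀ q ∈ certOf 29, q.1.Prime) ∧
    ((lamQ 29 : ℚ) : ℝ) ≤ θ ((blockR 29 : ℕ) : ℝ) + Real.log 2 / 100 * (NL (certOf 29) : ℝ) := by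
  refine ⟨by decide +kernel, certPrime_of_all (by simp only [certOf, cert29, List.map, List.Forall]; norm_num), ?_⟩
  have hθ := theta_block_lower (R := 1151) (nuR := 1017) (sR := 33927/1000) (by norm_num) (by norm_num) (by decide +kernel)
    (by norm_num) (by norm_num)
  refine lam_le_of (NLv := 52153) (by decide +kernel) hθ ?_
  simp only [lamQ, u2, piL, l2]; push_cast; norm_num

/-- piece `K = 30`: certificate sound, keys prime, `Λ_30 = lamQ 30 ≤ θ(1451) + (log 2/100)·NL`. -/
theorem piece30_ok : stairOK 30 (blockR 30) (blockNu 30) (certOf 30) = true ∧ (∀ q ∈ certOf 30, q.1.Prime) ∧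
    ((lamQ 30 : ℚ) : ℝ) ≤ θ ((blockR 30 : ℕ) : ℝ) + Real.log 2 / 100 * (NL (certOf 30) : ℝ) := by
  refine ⟨by decide +kernel, certPrime_of_all (by simp only [certOf, cert30, List.map, List.Forall]; norm_num), ?_⟩
  have hθ := theta_block_lower (R := 1451) (nuR := 1051) (sR := 9523/250) (by norm_num) (by norm_num) (by decide +kernel)
    (by norm_num) (by norm_num)
  refine lam_le_of (NLv := 60814) (by decide +kernel) hθ ?_
  simp only [lamQ, u2, piL, l2]; push_cast; norm_num

/-- piece `K = 31`: certificate sound, keys prime, `Λ_31 = lamQ 31 ≤ θ(1823) + (log 2/100)·NL`. -/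
theorem piece31_ok : stairOK 31 (blockR 31) (blockNu 31) (certOf 31) = true ∧ (∀ q ∈ certOf 31, q.1.Prime) ∧
    ((lamQ 31 : ℚ) : ℝ) ≤ θ ((blockR 31 : ℕ) : ℝ) + Real.log 2 / 100 * (NL (certOf 31) : ℝ) := by
  refine ⟨by decide +kernel, certPrime_of_all (by simp only [certOf, cert31, List.map, List.Forall]; norm_num), ?_⟩
  have hθ := theta_block_lower (R := 1823) (nuR := 1084) (sR := 42697/1000) (by norm_num) (by norm_num) (by decide +kernel)
    (by norm_num) (by norm_num)
  refine lam_le_of (NLv := 70442) (by decide +kernel) hθ ?_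
  simp only [lamQ, u2, piL, l2]; push_cast; norm_num

/-- piece `K = 32`: certificate sound, keys prime, `Λ_32 = lamQ 32 ≤ θ(2297) + (log 2/100)·NL`. -/
theorem piece32_ok : stairOK 32 (blockR 32) (blockNu 32) (certOf 32) = true ∧ (∀ q ∈ certOf 32, q.1.Prime) ∧
    ((lamQ 32 : ℚ) : ℝ) ≤ θ ((blockR 32 : ℕ) : ℝ) + Real.log 2 / 100 * (NL (certOf 32) : ℝ) := by
  refine ⟨by decide +kernel, certPrime_of_all (by simp only [certOf, cert32, List.map, List.Forall]; norm_num), ?_⟩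
  have hθ := theta_block_lower (R := 2297) (nuR := 1117) (sR := 5991/125) (by norm_num) (by norm_num) (by decide +kernel)
    (by norm_num) (by norm_num)
  refine lam_le_of (NLv := 83745) (by decide +kernel) hθ ?_
  simp only [lamQ, u2, piL, l2]; push_cast; norm_num

/-- piece `K = 33`: certificate sound, keys prime, `Λ_33 = lamQ 33 ≤ θ(2909) + (log 2/100)·NL`. -/
theorem piece33_ok : stairOK 33 (blockR 33) (blockNu 33) (certOf 33) = true ∧ (∀ q ∈ certOf 33, q.1.Prime) ∧
    ((lamQ 33 : ℚ) : ℝ) ≤ θ ((blockR 33 : ℕ) : ℝ) + Real.log 2 / 100 * (NL (certOf 33) : ℝ) := by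
  refine ⟨by decide +kernel, certPrime_of_all (by simp only [certOf, cert33, List.map, List.Forall]; norm_num), ?_⟩
  have hθ := theta_block_lower (R := 2909) (nuR := 1151) (sR := 6742/125) (by norm_num) (by norm_num) (by decide +kernel)
    (by norm_num) (by norm_num)
  refine lam_le_of (NLv := 95950) (by decide +kernel) hθ ?_
  simp only [lamQ, u2, piL, l2]; push_cast; norm_num

/-- piece `K = 34`: certificate sound, keys prime, `Λ_34 = lamQ 34 ≤ θ(3659) + (log 2/100)·NL`. -/
theorem piece34_ok : stairOK 34 (blockR 34) (blockNu 34) (certOf 34) = true ∧ (∀ q ∈ certOf 34, q.1.Prime) ∧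
    ((lamQ 34 : ℚ) : ℝ) ≤ θ ((blockR 34 : ℕ) : ℝ) + Real.log 2 / 100 * (NL (certOf 34) : ℝ) := by
  refine ⟨by decide +kernel, certPrime_of_all (by simp only [certOf, cert34, List.map, List.Forall]; norm_num), ?_⟩
  have hθ := theta_block_lower (R := 3659) (nuR := 1184) (sR := 6049/100) (by norm_num) (by norm_num) (by decide +kernel)
    (by norm_num) (by norm_num)
  refine lam_le_of (NLv := 114768) (by decide +kernel) hθ ?_
  simp only [lamQ, u2, piL, l2]; push_cast; norm_num

/-- piece `K = 35`: certificate sound, keys prime, `Λ_35 = lamQ 35 ≤ θ(4621) + (log 2/100)·NL`. -/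
theorem piece35_ok : stairOK 35 (blockR 35) (blockNu 35) (certOf 35) = true ∧ (∀ q ∈ certOf 35, q.1.Prime) ∧
    ((lamQ 35 : ℚ) : ℝ) ≤ θ ((blockR 35 : ℕ) : ℝ) + Real.log 2 / 100 * (NL (certOf 35) : ℝ) := by
  refine ⟨by decide +kernel, certPrime_of_all (by simp only [certOf, cert35, List.map, List.Forall]; norm_num), ?_⟩
  have hθ := theta_block_lower (R := 4621) (nuR := 1218) (sR := 33989/500) (by norm_num) (by norm_num) (by decide +kernel)
    (by norm_num) (by norm_num)
  refine lam_le_of (NLv := 131936) (by decide +kernel) hθ ?_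
  simp only [lamQ, u2, piL, l2]; push_cast; norm_num

/-- the pieces, dispatched on `K ∈ [22, 35]`. -/
theorem piece_ok {K : ℕ} (h22 : 22 ≤ K) (h35 : K ≤ 35) :
    stairOK K (blockR K) (blockNu K) (certOf K) = true ∧ (∀ q ∈ certOf K, q.1.Prime) ∧
    ((lamQ K : ℚ) : ℝ) ≤ θ ((blockR K : ℕ) : ℝ) + Real.log 2 / 100 * (NL (certOf K) : ℝ) := by
  interval_cases K
  · exact piece22_ok
  · exact piece23_ok
  · exact piece24_ok
  · exact piece25_ok
  · exact piece26_ok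
  · exact piece27_ok
  · exact piece28_ok
  · exact piece29_ok
  · exact piece30_ok
  · exact piece31_ok
  · exact piece32_ok
  · exact piece33_ok
  · exact piece34_ok
  · exact piece35_ok


/-- **THE STAIRCASE BOUND** (CA side, summed up): for a colossally abundant structure `(ε, P, Q)` with `2^K ≤ P`,
`K ∈ [22, 35]`: `θ(P) + θ(Q) + Λ_K ≤ log N`. -/
theorem theta_add_theta_add_lam_le_log {ε : ℝ} {N : ℕ} (h : IsCAParameter ε N) (hε : 0 < ε) (hN : N ≠ 0)
    {P Q K : ℕ} (hP : P.Prime) (hPN : P ∣ N) (hpf : N.primeFactors = primesLE P) (hQP : Q ≤ P)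
    (h2 : ∀ p ∈ primesLE Q, 2 ≤ N.factorization p) (hKP : 2 ^ K ≤ P) (h22 : 22 ≤ K) (h35 : K ≤ 35) :
    θ P + θ Q + ((lamQ K : ℚ) : ℝ) ≤ Real.log N := by
  obtain ⟨hc, hpr, hlam⟩ := piece_ok h22 h35
  have := staircase_le_log h hε hN hP hPN hpf hQP h2 hKP hc hpr
  linarith

end StaircasePieces

end Summit.RiemannHypothesis.RiemannHypothesis.Theorems.Splittings.RobinFiniteC1

end
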